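import Summits.Ventures.Crystal3D.Theorems.StickyWulffConstantCoaxialWallLawFrame
import Summits.Ventures.Crystal3D.Theorems.StickyWulffConstantCoaxialWallLawTilt
import Summits.Ventures.Crystal3D.Theorems.StickyWulffConstantGenericWallFloorMixedDozenRules
import Summits.Ventures.Crystal3D.Theorems.StickyWulffConstantGenericWallFloorSharedTriangle
import HarnessLib

/-!
# The in-plane riser slot of a co-axial grain: a non-descending slot of flux `≥ (√6/3)·sin θ` whose twin caps are never coherent terraces

HONEST FRAMING. Part of the venture `Summits/Ventures/Crystal3D` (cell `crystal3d-full`), helper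
`--supports` the crux `CoaxialWallLaw` (stmt-Ventures-19481, `route-Ventures-StickyWulffConstant`),
REGISTERED line `WallLedgerF` (planner cf-p1 gen 16), stub `stub_coaxialTwoSlabAdhesion`.
Input selection for the general-filling port of the riser ledger (this seat, gen 4).  Rung credit only;
F-C1 not moved.

For a grain `Λ₁ = A₁·Λ₀ + t₁` that is CO-AXIAL with the frame `L` (the crux hypothesis
`Λ₁ ⊆ L·B(σ) + s₁`, `σ` a Hägg sequence; axis `m = L e₃`), the three in-plane classes `L u₁`, `L u₂`,
`L (u₂ − u₁)` of the frame are slot vectors of the grain (`coaxial_inPlane_slot_mem`, `…CoaxialWallLawFrame`)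
and their vertical components add up to at least `√3 · sin ∠(e₃, m)` (`coaxial_sine_le_inPlaneClasses`,
`…CoaxialWallLawTilt`).  Hence:

* `exists_inPlane_slot_of_coaxial` — there is a slot `w ∈ fccSlots` of grain 1 that is IN-PLANE
  (`⟪A₁ w, L e₃⟫ = 0`), NON-DESCENDING (`0 ≤ ⟪A₁ w, e₃⟫`) and carries at least a third of the in-plane
  flux: `√6 · √(1 − ⟪L e₃, e₃⟫²) ≤ 3 · (√2 · |⟪A₁ w, e₃⟫|)` — the line class along which lane G's
  exit machine is run in the co-axial cell (`coaxial_ledger_ge_faces_add_payers`,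
  `card_onGrain_exits_below_ge`, `card_exits_le_restrict`);
* `twinCap_normal_ne_axis_of_inPlane` — a twin cap met along an in-plane slot is FOREIGN: its
  `{111}` normal `n` has `⟪A₁ w, n⟫ = √(2/3) ≠ 0 = ⟪A₁ w, ±m⟫`, so `n ≠ ±m`.  Coherent basal terraces and
  stacking faults (normal `±m`) therefore never cap an in-plane line: they are not in the residual of
  the co-axial general-filling rung.

WHAT THIS IS NOT: not the stub; no claim about foreign twin caps; F-C1 not moved.
-/

noncomputable section

namespace Summit.Ventures.Crystal3D.Theorems

open Summit.Ventures.Crystal3D Finset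
open Literature.MathematicalPhysics.StatisticalMechanics (fccStacking barlowStacking IsHaggSeq
  triangularVec₁ triangularVec₂)
open scoped InnerProductSpace

/-- The three in-plane generators of the model frame are horizontal: `⟪u₁, e₃⟫ = ⟪u₂, e₃⟫ = 0`. -/
theorem inner_triangularVec_e₃ :
    ⟪triangularVec₁ (1 : ℝ), EuclideanSpace.single (2 : Fin 3) (1 : ℝ)⟫_ℝ = 0 ∧
      ⟪triangularVec₂ (1 : ℝ), EuclideanSpace.single (2 : Fin 3) (1 : ℝ)⟫_ℝ = 0 := by
  refine ⟨?_, ?_⟩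
  · rw [EuclideanSpace.inner_single_right, triangularVec₁_one_apply.2.2]; simp
  · rw [EuclideanSpace.inner_single_right, triangularVec₂_one_apply.2.2]; simp

/-- **An in-plane class of a co-axial grain is a slot of the grain.**  If `Λ₁ = A₁·Λ₀ + t₁ ⊆ L·B(σ) + s₁`
(`σ` Hägg) and `v` is one of `u₁`, `u₂`, `u₂ − u₁` (more generally any vector with `x + L v ∈ Λ₁` for
some `x ∈ Λ₁` and `‖v‖ = 1`), then `L v = A₁ w` for a slot `w ∈ fccSlots`. -/
theorem exists_slot_eq_of_mem_sub
    (A₁ : EuclideanSpace ℝ (Fin 3) ≃ₗᵢ[ℝ] EuclideanSpace ℝ (Fin 3)) (t₁ : EuclideanSpace ℝ (Fin 3))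
    {x y : EuclideanSpace ℝ (Fin 3)}
    (hx : x ∈ (fun p => A₁ p + t₁) '' fccStacking 1 (Real.sqrt (2 / 3)))
    (hy : y ∈ (fun p => A₁ p + t₁) '' fccStacking 1 (Real.sqrt (2 / 3))) (hn : ‖y - x‖ = 1) :
    ∃ w ∈ fccSlots, A₁ w = y - x := by
  obtain ⟨w, hwΛ, hw⟩ := sub_mem_image_of_mem_affine A₁ t₁ y x hy hx
  refine ⟨w, mem_fccSlots_of_unit hwΛ ?_, hw⟩
  rw [← LinearIsometryEquiv.norm_map A₁, hw, hn]

/-- **The in-plane riser slot.**  Under the co-axiality hypothesis of the crux for grain 1 there is a slot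
`w` of grain 1 that is in-plane for the axis `m = L e₃`, non-descending, and carries a third of the
in-plane flux: `√6 · sin ∠(e₃, m) ≤ 3 · √2 · |⟪A₁ w, e₃⟫|`. -/
theorem exists_inPlane_slot_of_coaxial
    (A₁ : EuclideanSpace ℝ (Fin 3) ≃ₗᵢ[ℝ] EuclideanSpace ℝ (Fin 3)) (t₁ : EuclideanSpace ℝ (Fin 3))
    (L : EuclideanSpace ℝ (Fin 3) ≃ₗᵢ[ℝ] EuclideanSpace ℝ (Fin 3)) (s₁ : EuclideanSpace ℝ (Fin 3))
    {σ : ℤ → ℤ} (hσ : IsHaggSeq σ)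
    (hsub : (fun p => A₁ p + t₁) '' fccStacking 1 (Real.sqrt (2 / 3)) ⊆
      (fun p => L p + s₁) '' barlowStacking 1 (Real.sqrt (2 / 3)) σ) :
    ∃ w ∈ fccSlots, ⟪A₁ w, L (EuclideanSpace.single (2 : Fin 3) (1 : ℝ))⟫_ℝ = 0 ∧
      0 ≤ ⟪A₁ w, EuclideanSpace.single (2 : Fin 3) (1 : ℝ)⟫_ℝ ∧
      Real.sqrt 6 * Real.sqrt (1 - ⟪L (EuclideanSpace.single (2 : Fin 3) (1 : ℝ)),
          EuclideanSpace.single (2 : Fin 3) (1 : ℝ)⟫_ℝ ^ 2) ≤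
        3 * (Real.sqrt 2 * |⟪A₁ w, EuclideanSpace.single (2 : Fin 3) (1 : ℝ)⟫_ℝ|) := by
  set e₃ : EuclideanSpace ℝ (Fin 3) := EuclideanSpace.single (2 : Fin 3) (1 : ℝ) with he₃
  -- a base point of the grain
  obtain ⟨w₀, hw₀⟩ : ∃ w₀, w₀ ∈ fccSlots := Finset.card_pos.1 (by rw [card_fccSlots]; norm_num)
  have hx : A₁ w₀ + t₁ ∈ (fun p => A₁ p + t₁) '' fccStacking 1 (Real.sqrt (2 / 3)) :=
    ⟨w₀, mem_fcc_of_mem_fccSlots hw₀, rfl⟩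
  -- the three in-plane classes are slot vectors of the grain
  obtain ⟨hn₁, hn₂, hn₁₂⟩ := norm_triangularVec_one
  have hcls : ∀ v : EuclideanSpace ℝ (Fin 3), ‖v‖ = 1 → ⟪v, e₃⟫_ℝ = 0 →
      (∃ i j : ℤ, v = (i : ℝ) • triangularVec₁ 1 + (j : ℝ) • triangularVec₂ 1) →
      ∃ w ∈ fccSlots, A₁ w = L v ∧ ⟪A₁ w, L e₃⟫_ℝ = 0 ∧ ⟪A₁ w, e₃⟫_ℝ = ⟪L v, e₃⟫_ℝ := by
    intro v hv hv3 ⟨i, j, hij⟩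
    have hy := coaxial_inPlane_slot_mem A₁ t₁ L s₁ hσ hsub hx i j
    rw [← hij] at hy
    obtain ⟨w, hw, hAw⟩ := exists_slot_eq_of_mem_sub A₁ t₁ hx hy
      (by rw [add_sub_cancel_left, LinearIsometryEquiv.norm_map, hv])
    rw [add_sub_cancel_left] at hAw
    refine ⟨w, hw, hAw, ?_, by rw [hAw]⟩
    rw [hAw, LinearIsometryEquiv.inner_map_map, hv3]
  obtain ⟨h₁3, h₂3⟩ := inner_triangularVec_e₃
  obtain ⟨a, ha, -, ha0, hae⟩ := hcls (triangularVec₁ 1) hn₁ h₁3 ⟨1, 0, by simp⟩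
  obtain ⟨b, hb, -, hb0, hbe⟩ := hcls (triangularVec₂ 1) hn₂ h₂3 ⟨0, 1, by simp⟩
  obtain ⟨c, hc, -, hc0, hce⟩ := hcls (triangularVec₂ 1 - triangularVec₁ 1) hn₁₂
    (by rw [inner_sub_left, h₁3, h₂3, sub_zero]) ⟨-1, 1, by simp [add_comm, sub_eq_add_neg]⟩
  -- the tilt inequality: the three fluxes add up to at least `√6 sin θ`
  have htilt := coaxial_sine_le_inPlaneClasses L
  rw [← hae, ← hbe, ← hce] at htilt
  -- sign flip keeps everything
  have flip : ∀ w ∈ fccSlots, ⟪A₁ w, L e₃⟫_ℝ = 0 →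
      ∃ w' ∈ fccSlots, ⟪A₁ w', L e₃⟫_ℝ = 0 ∧ 0 ≤ ⟪A₁ w', e₃⟫_ℝ ∧ |⟪A₁ w', e₃⟫_ℝ| = |⟪A₁ w, e₃⟫_ℝ| := by
    intro w hw hw0
    by_cases hsgn : 0 ≤ ⟪A₁ w, e₃⟫_ℝ
    · exact ⟨w, hw, hw0, hsgn, rfl⟩
    · refine ⟨-w, neg_mem_fccSlots hw, ?_, ?_, ?_⟩
      · rw [map_neg, inner_neg_left, hw0, neg_zero]
      · rw [map_neg, inner_neg_left]; linarith
      · rw [map_neg, inner_neg_left, abs_neg]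
  -- pick the largest of the three
  have h3 : Real.sqrt 6 * Real.sqrt (1 - ⟪L e₃, e₃⟫_ℝ ^ 2) ≤ 3 * (Real.sqrt 2 * |⟪A₁ a, e₃⟫_ℝ|) ∨
      Real.sqrt 6 * Real.sqrt (1 - ⟪L e₃, e₃⟫_ℝ ^ 2) ≤ 3 * (Real.sqrt 2 * |⟪A₁ b, e₃⟫_ℝ|) ∨
      Real.sqrt 6 * Real.sqrt (1 - ⟪L e₃, e₃⟫_ℝ ^ 2) ≤ 3 * (Real.sqrt 2 * |⟪A₁ c, e₃⟫_ℝ|) := by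
    by_contra hnot
    push Not at hnot
    obtain ⟨h1, h2, h3⟩ := hnot
    have hs : 0 ≤ Real.sqrt 2 := Real.sqrt_nonneg 2
    nlinarith [htilt, h1, h2, h3, mul_add (Real.sqrt 2) (|⟪A₁ a, e₃⟫_ℝ| + |⟪A₁ b, e₃⟫_ℝ|) |⟪A₁ c, e₃⟫_ℝ|,
      mul_add (Real.sqrt 2) |⟪A₁ a, e₃⟫_ℝ| |⟪A₁ b, e₃⟫_ℝ|]
  rcases h3 with h | h | h
  · obtain ⟨w', hw', h0, hpos, habs⟩ := flip a ha ha0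
    exact ⟨w', hw', h0, hpos, by rwa [habs]⟩
  · obtain ⟨w', hw', h0, hpos, habs⟩ := flip b hb hb0
    exact ⟨w', hw', h0, hpos, by rwa [habs]⟩
  · obtain ⟨w', hw', h0, hpos, habs⟩ := flip c hc hc0
    exact ⟨w', hw', h0, hpos, by rwa [habs]⟩

/-- **Twin caps along an in-plane slot are foreign.**  If `⟪A₁ w, m⟫ = 0` and a `{111}` normal `n`
has `⟪A₁ w, n⟫ = √(2/3)` (the exit-lemma relation between the capping normal and the line slot), then
`n ≠ m` and `n ≠ −m`: coherent terraces / stacking faults of the common frame never cap an in-plane line. -/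
theorem twinCap_normal_ne_axis_of_inPlane
    (A₁ : EuclideanSpace ℝ (Fin 3) ≃ₗᵢ[ℝ] EuclideanSpace ℝ (Fin 3)) {w m n : EuclideanSpace ℝ (Fin 3)}
    (hm : ⟪A₁ w, m⟫_ℝ = 0) (hn : ⟪A₁ w, n⟫_ℝ = Real.sqrt (2 / 3)) : n ≠ m ∧ n ≠ -m := by
  have hpos : 0 < Real.sqrt (2 / 3) := Real.sqrt_pos.2 (by norm_num)
  refine ⟨?_, ?_⟩
  · rintro rfl
    rw [hm] at hn
    linarith
  · rintro rfl
    rw [inner_neg_right, hm, neg_zero] at hn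
    linarith

open scoped Classical in
/-- **The residual of an in-plane line consists of FOREIGN caps** (filter form used by the co-axial
general-filling rung): for an in-plane slot `w` (`⟪A₁ w, L e₃⟫ = 0`) the twin-capped `w`-exits of any
sub-family `S` are exactly those whose capping normal is, in addition, different from `±L e₃`. -/
theorem filter_twinCapped_eq_foreign_of_inPlane
    (A₁ : EuclideanSpace ℝ (Fin 3) ≃ₗᵢ[ℝ] EuclideanSpace ℝ (Fin 3))
    (L : EuclideanSpace ℝ (Fin 3) ≃ₗᵢ[ℝ] EuclideanSpace ℝ (Fin 3)) (X S : Finset (EuclideanSpace ℝ (Fin 3)))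
    {w : EuclideanSpace ℝ (Fin 3)} (hw : ⟪A₁ w, L (EuclideanSpace.single (2 : Fin 3) (1 : ℝ))⟫_ℝ = 0) :
    (S.filter fun e => ∃ n : EuclideanSpace ℝ (Fin 3), ‖n‖ = 1 ∧
        (∀ v ∈ fccSlots, ⟪A₁ v, n⟫_ℝ = 0 ∨ ⟪A₁ v, n⟫_ℝ = Real.sqrt (2 / 3) ∨ ⟪A₁ v, n⟫_ℝ = -Real.sqrt (2 / 3)) ∧
        ⟪A₁ w, n⟫_ℝ = Real.sqrt (2 / 3) ∧
        (∀ v ∈ fccSlots, ⟪A₁ v, n⟫_ℝ ≤ 0 → e + A₁ v ∈ X) ∧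
        (∀ v ∈ fccSlots, 0 < ⟪A₁ v, n⟫_ℝ → e + A₁ v ∉ X ∧ e - A₁ v + (2 * ⟪A₁ v, n⟫_ℝ) • n ∈ X)) =
    (S.filter fun e => ∃ n : EuclideanSpace ℝ (Fin 3), ‖n‖ = 1 ∧
        n ≠ L (EuclideanSpace.single (2 : Fin 3) (1 : ℝ)) ∧ n ≠ -L (EuclideanSpace.single (2 : Fin 3) (1 : ℝ)) ∧
        (∀ v ∈ fccSlots, ⟪A₁ v, n⟫_ℝ = 0 ∨ ⟪A₁ v, n⟫_ℝ = Real.sqrt (2 / 3) ∨ ⟪A₁ v, n⟫_ℝ = -Real.sqrt (2 / 3)) ∧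
        ⟪A₁ w, n⟫_ℝ = Real.sqrt (2 / 3) ∧
        (∀ v ∈ fccSlots, ⟪A₁ v, n⟫_ℝ ≤ 0 → e + A₁ v ∈ X) ∧
        (∀ v ∈ fccSlots, 0 < ⟪A₁ v, n⟫_ℝ → e + A₁ v ∉ X ∧ e - A₁ v + (2 * ⟪A₁ v, n⟫_ℝ) • n ∈ X)) := by
  refine Finset.filter_congr fun e _ => ⟨?_, ?_⟩
  · rintro ⟨n, hn1, hlat, hwn, hocc, hmir⟩
    obtain ⟨hne, hne'⟩ := twinCap_normal_ne_axis_of_inPlane A₁ hw hwn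
    exact ⟨n, hn1, hne, hne', hlat, hwn, hocc, hmir⟩
  · rintro ⟨n, hn1, -, -, hlat, hwn, hocc, hmir⟩
    exact ⟨n, hn1, hlat, hwn, hocc, hmir⟩

end Summit.Ventures.Crystal3D.Theorems

end
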